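import Summits.KontsevichZagierPeriods.KontsevichZagierPeriods.Theorems.UnfoldedStokesDefs
import Summits.KontsevichZagierPeriods.KontsevichZagierPeriods.Theorems.UnfoldedStokesStokesGenerationLineReduction
import Literature.NumberTheory.Transcendental.KZProductIdeal
import Literature.NumberTheory.Transcendental.KZIntervalPeriodProofs

/-!
# `StokesGeneration` (stmt-KontsevichZagierPeriods-3586) — line `fibrewise_stokes`, stub `fibStokesDecomposable_pad`

Closure properties of the S2 class, II: PADDING. The residual S2 of the line (`FibrewiseStokesGenerationConjecture`)
concludes with the package `FibStokesDecomposable M h` of the route's definitions file (`Theorems/UnfoldedStokesDefs.lean`):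
after padding by dummy variables and off a null `ℚ`-semialgebraic set, `h` is a finite sum of fibrewise Stokes
elements carried by closed-cube representations. This file proves that the class is stable under padding of the
SOURCE: if `h` on `[0,1]^M` is decomposable then so is `x ↦ h (x_0, …, x_{M-1})` on `[0,1]^N` for `M ≤ N`.

Proof (pure bookkeeping, no analysis). Take the given package on the padded cube `[0,1]^{M'}` and embed it as the
block of the first `M'` coordinates of `[0,1]^{M'+N}` (`N ≤ M' + N` is the new padding): primitives, derivatives, kink
sets and the null set are pulled back along the coordinate projection `pr x = (x_k)_{k<M'}` — semialgebraic by
composition with a coordinate map (`IsSemialgebraicFunOn.comp_isSemialgebraicMapOn_holds`) and coordinate preimages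
(`IsSemialgebraic.preimage_comp`), the pulled-back null set is the cylinder `Z × ℝ^N` of measure `vol Z · ∞ = 0`
(`KZ.volume_cylinder`); the fibre facts transport because updating the coordinate `i j` commutes with `pr`
(`castAdd_update`); and the carried closed-cube representations are lifted by iterated Newton–Leibniz slabs,
`[□^{M'}, f] ∼ [□^{M'+N}, f ∘ pr]` (`StokesGenerationLine.exists_liftCube`). The defining identity at `x` is the old
identity at `pr x`, both arguments of `h` being `(x_0, …, x_{M-1})`.

References: J. Ayoub, *Une version relative de la conjecture des périodes de Kontsevich–Zagier*, Ann. of Math. 181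
(2015), Rem. 1.5; J. Bochnak, M. Coste, M.-F. Roy, *Real Algebraic Geometry* (1998), §2.1–2.2; M. Kontsevich,
D. Zagier, *Periods* (2001), §1.2 rule (3).
-/

noncomputable section

-- `Summit.KontsevichZagierPeriods.KontsevichZagierPeriods.…` is the tree's mandated layout (single-conjunct summit).
set_option linter.dupNamespace false

namespace Summit.KontsevichZagierPeriods.KontsevichZagierPeriods.Cruxes.StokesGeneration.FibrewiseStokes

open MeasureTheory Set
open Literature.NumberTheory.Transcendental
open Literature.NumberTheory.Transcendental.KZ
open Literature.ModelTheory.ExponentialFields (IsSemialgebraic)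
open Summit.KontsevichZagierPeriods.KontsevichZagierPeriods.StokesGenerationLine (exists_liftCube)

/-- Updating a coordinate of the leading block commutes with the projection `x ↦ (x_k)_{k<M'}` of `ℝ^{M'+N}` onto
its first `M'` coordinates. [folklore] -/
theorem castAdd_update {M' N : ℕ} (x : Fin (M' + N) → ℝ) (a : Fin M') (s : ℝ) :
    (fun k => Function.update x (Fin.castAdd N a) s (Fin.castAdd N k)) =
      Function.update (fun k => x (Fin.castAdd N k)) a s := by
  ext k
  by_cases hk : k = a
  · subst hk; simp
  · rw [Function.update_of_ne hk, Function.update_of_ne (fun h => hk (Fin.castAdd_injective M' N h))]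

/-- The cylinder over a Lebesgue-null set of the leading block is null: `vol (Z × ℝ^N) = vol Z · vol ℝ^N = 0`.
[folklore] -/
theorem volume_setOf_castAdd_mem_eq_zero {M' N : ℕ} {Z : Set (Fin M' → ℝ)} (hZ0 : volume Z = 0) :
    volume {x : Fin (M' + N) → ℝ | (fun k => x (Fin.castAdd N k)) ∈ Z} = 0 := by
  have h := KZ.volume_cylinder (A := Z) (B := (Set.univ : Set (Fin N → ℝ)))
  simp only [Set.mem_univ, and_true] at h
  rw [h, hZ0, zero_mul]

/-- **Padding (registered stub `fibStokesDecomposable_pad`).** The class of fibrewise-Stokes decomposable functions is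
stable under padding of the source by dummy variables: embed the given package as the leading block of coordinates of
the cube of dimension `M' + N`, pull primitives, derivatives, kink sets and the null set back along the coordinate
projection (a null cylinder, `KZ.volume_cylinder`), and lift the carried closed-cube representations by Newton–Leibniz
slabs (`exists_liftCube`). [cite: KontsevichZagier2001, §1.2 rule (3)] -/
theorem fibStokesDecomposable_pad :
    ∀ (M N : ℕ) (hMN : M ≤ N) (h : (Fin M → ℝ) → ℝ), FibStokesDecomposable M h →
      FibStokesDecomposable N (fun x => h (fun l => x (Fin.castLE hMN l))) := by
  intro M N hMN h ⟨M', hMM', J, i, G, D, K, q, Z, hpack, hq, hZs, hZ0, hid⟩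
  -- the old padded cube `S`, the new one `T` (dimension `M' + N`), the projection `pr x = (x_k)_{k<M'}`
  set S : Set (Fin M' → ℝ) := Set.pi Set.univ (fun _ : Fin M' => Set.Icc (0:ℝ) 1) with hS
  set T : Set (Fin (M' + N) → ℝ) := Set.pi Set.univ (fun _ : Fin (M' + N) => Set.Icc (0:ℝ) 1) with hT
  have hTsa : IsSemialgebraic ℚ T := by rw [hT, ← cube_eq_pi]; exact isSemialgebraic_cube
  have hprS : ∀ x ∈ T, (fun k => x (Fin.castAdd N k)) ∈ S :=
    fun x hx k _ => hx (Fin.castAdd N k) (Set.mem_univ _)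
  have hpr : IsSemialgebraicMapOn ℚ T (fun (x : Fin (M' + N) → ℝ) (k : Fin M') => x (Fin.castAdd N k)) :=
    IsSemialgebraicMapOn.of_forall hTsa fun k => isSemialgebraicFunOn_apply hTsa (Fin.castAdd N k)
  have hmaps : MapsTo (fun (x : Fin (M' + N) → ℝ) (k : Fin M') => x (Fin.castAdd N k)) T S :=
    fun x hx => hprS x hx
  -- lift the carried representations to the big cube
  have hlift : ∀ j, ∃ t' : IntegralRep (M' + N), t'.domain = T ∧
      ∀ x ∈ T, t'.integrand x = (q j).integrand (fun k => x (Fin.castAdd N k)) := fun j => by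
    obtain ⟨t', h1, h2, -⟩ := exists_liftCube M' (M' + N) (Nat.le_add_right M' N) (q j) (hq j).1
    exact ⟨t', h1, h2⟩
  choose q' hq'd hq'i using hlift
  refine ⟨M' + N, Nat.le_add_left N M', J, fun j => Fin.castAdd N (i j),
    fun j x => G j (fun k => x (Fin.castAdd N k)), fun j x => D j (fun k => x (Fin.castAdd N k)),
    fun j => {x | (fun k => x (Fin.castAdd N k)) ∈ K j}, q', {x | (fun k => x (Fin.castAdd N k)) ∈ Z},
    fun j => ?_, fun j => ⟨hq'd j, fun x hx => ?_⟩, hZs.preimage_comp (Fin.castAdd N),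
    volume_setOf_castAdd_mem_eq_zero hZ0, fun x hx hxZ => ?_⟩
  · obtain ⟨h1, h2, h3, ⟨B, hB⟩, h5, h6, h7⟩ := hpack j
    refine ⟨IsSemialgebraicFunOn.comp_isSemialgebraicMapOn_holds h1 hpr hmaps,
      IsSemialgebraicFunOn.comp_isSemialgebraicMapOn_holds h2 hpr hmaps, h3.preimage_comp (Fin.castAdd N),
      ⟨B, fun x hx => hB _ (hprS x hx)⟩, fun x hx => ?_, fun x hx => ?_, fun x hx hxK hxj => ?_⟩
    · refine (h5 _ (hprS x hx)).subset fun s hs => ?_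
      simp only [Set.mem_setOf_eq] at hs ⊢
      rwa [← castAdd_update x (i j) s]
    · refine (h6 _ (hprS x hx)).congr fun s _ => ?_
      show G j (fun k => Function.update x (Fin.castAdd N (i j)) s (Fin.castAdd N k)) =
        G j (Function.update (fun k => x (Fin.castAdd N k)) (i j) s)
      rw [castAdd_update]
    · have hK : (fun k => x (Fin.castAdd N k)) ∉ K j := hxK
      have hd := h7 _ (hprS x hx) hK hxj
      refine hd.congr_of_eventuallyEq (Filter.Eventually.of_forall fun s => ?_)
      show G j (fun k => Function.update x (Fin.castAdd N (i j)) s (Fin.castAdd N k)) =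
        G j (Function.update (fun k => x (Fin.castAdd N k)) (i j) s)
      rw [castAdd_update]
  · show (q' j).integrand x = D j (fun k => x (Fin.castAdd N k)) -
      (G j (fun k => Function.update x (Fin.castAdd N (i j)) 1 (Fin.castAdd N k)) -
        G j (fun k => Function.update x (Fin.castAdd N (i j)) 0 (Fin.castAdd N k)))
    rw [hq'i j x hx, (hq j).2 _ (hprS x hx), castAdd_update, castAdd_update]
  · have hxZ' : (fun k => x (Fin.castAdd N k)) ∉ Z := hxZ
    have := hid _ (hprS x hx) hxZ'
    show h (fun l => x (Fin.castLE (Nat.le_add_left N M') (Fin.castLE hMN l))) = ∑ j, (q' j).integrand x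
    rw [Finset.sum_congr rfl fun j _ => hq'i j x hx]
    exact this

end Summit.KontsevichZagierPeriods.KontsevichZagierPeriods.Cruxes.StokesGeneration.FibrewiseStokes

end
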